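import Summits.CriticalPhenomena.PercolationContinuityZ3.Theorems.SubpolynomialBlocking.Negative.OffCritical
import Literature.Probability.Percolation.Crossings
import Literature.Barriers.CriticalPhenomena.TransverseCrossingsNeedNotMeetNarrow
import Literature.Probability.Percolation.PlanarDuality
import Literature.Probability.Percolation.BondPercolationSymmetry
import Literature.Probability.Percolation.SiteConnectionTools
import Literature.Probability.Percolation.LatticeSymmetry
import Literature.Probability.Percolation.HalfSpacePinnedPairs
import Literature.Probability.Percolation.HalfSpaceBrickSymmetry
import Literature.Probability.Percolation.CornerPercolation
import HarnessLib

/-!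
# Crux `PercNonProliferation.SubpolynomialBlocking` (stmt-CriticalPhenomena-4446), line `cross-sandwich-flat-seal` — stub `stub_sixSlab`

Helper file for the crux skeleton `Cruxes/SubpolynomialBlocking/Lines/cross-sandwich-flat-seal.lean`
(lead prover-line-stmt-CriticalPhenomena-4446-0). Proves exactly the registered stub signature
`stub_sixSlab`; lands with `--supports stmt-CriticalPhenomena-4446`.

## The statement (lower sandwich `V_n⁶ ≤ u_n`)

At `p = p_c(ℤ³)` let `u_n = blockProb 3 p_c n = P((annulusCrossing 3 n)ᶜ)` be the probability that
no open path inside `Λ_{2n} = [-2n, 2n]³` joins `Λ_n` to `∂ⁱⁿΛ_{2n}`, and let `V_n` be the probability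
that the face-slab `[n, 2n] × [-2n, 2n]²` (the box `Set.Icc ![n, -2n, -2n] ![2n, 2n, 2n]` of the
product order on `Site 3 = Fin 3 → ℤ`) is SEALED across direction `0`: no open path inside the slab
joins its inner face `{x₀ = n}` to its outer face `{x₀ = 2n}` (the complement of an `openCrossing`
event). Then `V_n ^ 6 ≤ u_n` for every `n ≥ 1` (in fact for every `n`).

## The argument

* DETERMINISTIC (`StubSixSlab.not_mem_annulusCrossing`). The six face-slabs of the shell
  `Λ_{2n} ∖ Λ_n` are the images of the reference slab under the six signed coordinate permutations
  `σ_{i,ε} = zdSignedPermIso (Equiv.swap 0 i) (fun _ => ε)` (`i : Fin 3`, `ε = ±1`), whose inverse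
  has `0`-th coordinate `ε z_i`. If a lattice configuration `ω ⊆ E(ℤ³)` seals all six image slabs,
  every lattice walk of the slab `{n ≤ ε z_i}` of `Λ_{2n}` from `{ε z_i = n}` to `{ε z_i = 2n}` uses
  a non-open edge (`StubSixSlab.exists_edge_not_mem`, via `mem_openConnIn_of_walk`), which is the
  hypothesis of the barrier file's `shell_cutsets_glue` with all six cutsets equal to the closed
  edges; an open walk from `Λ_n` to `∂ⁱⁿΛ_{2n}` inside `Λ_{2n}` (`exists_walk_of_mem_openConnIn`,
  `exists_eq_of_mem_innerBoundary_box`) would then contain a closed edge — contradiction.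
* MEASURE. `real_mono_of_forall_subset_edgeSet` turns the inclusion into
  `P(⋂ six seals) ≤ u_n`; the seals are decreasing (`isUpperSet_openCrossing`, complemented) and
  measurable (`measurableSet_openCrossing_of_countable`), so Harris–FKG iterated over the finite
  index set `Fin 3 × ℤˣ` (`prob_pow_le_biInter_of_isLowerSet`, Grimmett 1999 Thm. 2.4) gives
  `∏ P(seal_{i,ε}) ≤ P(⋂)`; and each image seal has probability `V_n` by invariance of `P_p` under
  lattice automorphisms (`bondPercolation_real_preimage_relabel_iso`, `preimage_relabel_openCrossing`,
  Grimmett 1999 §1.6), `StubSixSlab.real_compl_openCrossing_image`. Hence `V_n⁶ = ∏ ≤ u_n`.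

No new definitions; the six events are written as images of the three sets of the signature.
-/

noncomputable section

namespace Summit.CriticalPhenomena.PercolationContinuityZ3.Theorems.SubpolynomialBlocking

open MeasureTheory Filter Topology
open Literature.Probability.Percolation Literature.Probability.LatticeModels
open Literature.Probability.Percolation.DCT16
open Literature.Barriers.CriticalPhenomena
open Summit.CriticalPhenomena.PercolationContinuityZ3.Theorems.SubpolynomialBlocking.Negative

namespace StubSixSlab

/-! ### Symmetry: image seals are equally likely -/

/-- **Invariance of sealing probabilities under graph isomorphisms**: for `φ : G ≃g H`,
`P_p^H((C(φS; φA, φB))ᶜ) = P_p^G((C(S; A, B))ᶜ)` (Grimmett 1999, §1.6: invariance of `P_p` under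
lattice symmetries; `bondPercolation_real_preimage_relabel_iso` and `preimage_relabel_openCrossing`). -/
theorem real_compl_openCrossing_image {V W : Type*} {G : SimpleGraph V} {H : SimpleGraph W}
    (φ : G ≃g H) (p : unitInterval) (S A B : Set V) :
    (bondPercolation H p).real (openCrossing (φ '' S) (φ '' A) (φ '' B))ᶜ =
      (bondPercolation G p).real (openCrossing S A B)ᶜ := by
  have h := bondPercolation_real_preimage_relabel_iso φ p (openCrossing (φ '' S) (φ '' A) (φ '' B))ᶜ
  rw [Set.preimage_compl] at h
  rw [← h]
  exact congrArg (fun s => (bondPercolation G p).real sᶜ)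
    (preimage_relabel_openCrossing φ.toEquiv S A B)

/-! ### The reference slab `[N, 2N] × [-2N, 2N]²` and its signed-permutation images -/

/-- Membership in the reference slab `Set.Icc ![N, -2N, -2N] ![2N, 2N, 2N]`, coordinatewise. -/
theorem mem_refSlab_iff {N : ℤ} {w : Site 3} :
    w ∈ Set.Icc (![N, -(2 * N), -(2 * N)] : Site 3) ![2 * N, 2 * N, 2 * N] ↔
      (N ≤ w 0 ∧ -(2 * N) ≤ w 1 ∧ -(2 * N) ≤ w 2) ∧ (w 0 ≤ 2 * N ∧ w 1 ≤ 2 * N ∧ w 2 ≤ 2 * N) := by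
  simp only [Set.mem_Icc, Pi.le_def, Fin.forall_fin_succ, IsEmpty.forall_iff, and_true,
    Matrix.cons_val_zero, Matrix.cons_val_succ, Fin.succ_zero_eq_one, Fin.succ_one_eq_two]

/-- Coordinates of the inverse of a signed coordinate permutation of `ℤ³`:
`(σ_{π,ε}⁻¹ y)_j = ε_{π j} y_{π j}`. -/
theorem iso_symm_apply (π : Equiv.Perm (Fin 3)) (ε : Fin 3 → ℤˣ) (y : Site 3) (j : Fin 3) :
    (zdSignedPermIso π ε).symm y j = (ε (π j) : ℤ) * y (π j) := rfl

/-- The inverse signed permutation `σ_{i,ε}⁻¹` (`σ_{i,ε} = zdSignedPermIso (swap 0 i) (fun _ => ε)`)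
maps the slab `{z ∈ Λ_{2N} : N ≤ ε z_i}` into the reference slab. -/
theorem symm_mem_refSlab {N : ℤ} (i : Fin 3) (ε : ℤˣ) {z : Site 3}
    (hz : ∀ j, -(2 * N) ≤ z j ∧ z j ≤ 2 * N) (hi : N ≤ (ε : ℤ) * z i) :
    (zdSignedPermIso (Equiv.swap (0 : Fin 3) i) (fun _ => ε)).symm z ∈
      Set.Icc (![N, -(2 * N), -(2 * N)] : Site 3) ![2 * N, 2 * N, 2 * N] := by
  have hε : ∀ k, -(2 * N) ≤ (ε : ℤ) * z k ∧ (ε : ℤ) * z k ≤ 2 * N := fun k => by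
    have hk := hz k
    rcases Int.units_eq_one_or ε with rfl | rfl
    · simpa using hk
    · simp only [Units.val_neg, Units.val_one]
      omega
  rw [mem_refSlab_iff]
  simp only [iso_symm_apply, Equiv.swap_apply_left]
  exact ⟨⟨hi, (hε _).1, (hε _).1⟩, (hε _).2, (hε _).2, (hε _).2⟩

/-- The `0`-th coordinate of `σ_{i,ε}⁻¹ z` is `ε z_i`. -/
theorem symm_apply_zero (i : Fin 3) (ε : ℤˣ) (z : Site 3) :
    (zdSignedPermIso (Equiv.swap (0 : Fin 3) i) (fun _ => ε)).symm z 0 = (ε : ℤ) * z i := by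
  rw [iso_symm_apply, Equiv.swap_apply_left]

/-- **Seal ⇒ cutset.** If `ω` does not cross the image slab `σ_{i,ε}(reference slab)` between the
images of its two faces, then every lattice walk of the slab `{z ∈ Λ_{2N} : N ≤ ε z_i}` from
`{ε z_i = N}` to `{ε z_i = 2N}` uses an edge outside `ω` (otherwise `mem_openConnIn_of_walk`
exhibits the forbidden crossing). -/
theorem exists_edge_not_mem {N : ℤ} {ω : BondConfig (Site 3)} (i : Fin 3) (ε : ℤˣ)
    (h : ω ∉ openCrossing
        ((zdSignedPermIso (Equiv.swap (0 : Fin 3) i) (fun _ => ε)) ''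
          Set.Icc (![N, -(2 * N), -(2 * N)] : Site 3) ![2 * N, 2 * N, 2 * N])
        ((zdSignedPermIso (Equiv.swap (0 : Fin 3) i) (fun _ => ε)) ''
          {x | x ∈ Set.Icc (![N, -(2 * N), -(2 * N)] : Site 3) ![2 * N, 2 * N, 2 * N] ∧ x 0 = N})
        ((zdSignedPermIso (Equiv.swap (0 : Fin 3) i) (fun _ => ε)) ''
          {y | y ∈ Set.Icc (![N, -(2 * N), -(2 * N)] : Site 3) ![2 * N, 2 * N, 2 * N] ∧
            y 0 = 2 * N}))
    {a b : Site 3} (P : (zdGraph 3).Walk a b)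
    (hP : ∀ z ∈ P.support, (∀ j, -(2 * N) ≤ z j ∧ z j ≤ 2 * N) ∧ N ≤ (ε : ℤ) * z i)
    (ha : (ε : ℤ) * a i = N) (hb : (ε : ℤ) * b i = 2 * N) : ∃ x ∈ P.edges, x ∉ ω := by
  by_contra hne
  push Not at hne
  refine h ⟨a, ?_, b, ?_, mem_openConnIn_of_walk P (fun z hz => ?_) hne⟩
  · exact ⟨_, ⟨symm_mem_refSlab i ε (hP a P.start_mem_support).1 (hP a P.start_mem_support).2,
      by rw [symm_apply_zero]; exact ha⟩, RelIso.apply_symm_apply _ a⟩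
  · exact ⟨_, ⟨symm_mem_refSlab i ε (hP b P.end_mem_support).1 (hP b P.end_mem_support).2,
      by rw [symm_apply_zero]; exact hb⟩, RelIso.apply_symm_apply _ b⟩
  · exact ⟨_, symm_mem_refSlab i ε (hP z hz).1 (hP z hz).2, RelIso.apply_symm_apply _ z⟩

/-- **Six seals close the shell** (deterministic, lattice configurations). If `ω ⊆ E(ℤ³)` seals
the six signed-permutation images of the reference slab `[n, 2n] × [-2n, 2n]²`, then no open path
inside `Λ_{2n}` joins `Λ_n` to `∂ⁱⁿΛ_{2n}`: `shell_cutsets_glue` with all six cutsets equal to the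
closed edges, applied to the lattice walk of `exists_walk_of_mem_openConnIn`. -/
theorem not_mem_annulusCrossing {n : ℕ} {ω : BondConfig (Site 3)} (hω : ω ⊆ (zdGraph 3).edgeSet)
    (h : ∀ (i : Fin 3) (ε : ℤˣ), ω ∉ openCrossing
        ((zdSignedPermIso (Equiv.swap (0 : Fin 3) i) (fun _ => ε)) ''
          Set.Icc (![(n : ℤ), -(2 * (n : ℤ)), -(2 * (n : ℤ))] : Site 3)
            ![2 * (n : ℤ), 2 * (n : ℤ), 2 * (n : ℤ)])
        ((zdSignedPermIso (Equiv.swap (0 : Fin 3) i) (fun _ => ε)) ''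
          {x | x ∈ Set.Icc (![(n : ℤ), -(2 * (n : ℤ)), -(2 * (n : ℤ))] : Site 3)
            ![2 * (n : ℤ), 2 * (n : ℤ), 2 * (n : ℤ)] ∧ x 0 = (n : ℤ)})
        ((zdSignedPermIso (Equiv.swap (0 : Fin 3) i) (fun _ => ε)) ''
          {y | y ∈ Set.Icc (![(n : ℤ), -(2 * (n : ℤ)), -(2 * (n : ℤ))] : Site 3)
            ![2 * (n : ℤ), 2 * (n : ℤ), 2 * (n : ℤ)] ∧ y 0 = 2 * (n : ℤ)})) :
    ω ∉ annulusCrossing 3 n := by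
  rintro ⟨x, hx, y, hy, hxy⟩
  obtain ⟨P, hPS, hPω⟩ := exists_walk_of_mem_openConnIn hω hxy
  have hP : ∀ z ∈ P.support, ∀ j, -(2 * (n : ℤ)) ≤ z j ∧ z j ≤ 2 * (n : ℤ) := fun z hz j => by
    have h1 := (mem_box.1 (hPS z hz)) j
    push_cast at h1
    exact h1
  have hx' : ∀ j, -(n : ℤ) ≤ x j ∧ x j ≤ (n : ℤ) := fun j => mem_box.1 hx j
  have hy' : ∃ i, y i = 2 * (n : ℤ) ∨ y i = -(2 * (n : ℤ)) := by
    obtain ⟨i, hi⟩ := exists_eq_of_mem_innerBoundary_box hy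
    refine ⟨i, ?_⟩
    push_cast at hi
    exact hi
  have hpos : ∀ (i : Fin 3) (a b : Site 3) (Q : (zdGraph 3).Walk a b),
      (∀ z ∈ Q.support, (∀ j, -(2 * (n : ℤ)) ≤ z j ∧ z j ≤ 2 * (n : ℤ)) ∧ (n : ℤ) ≤ z i) →
      a i = (n : ℤ) → b i = 2 * (n : ℤ) →
      ∃ e ∈ Q.edges, e ∈ (fun _ : Fin 3 => {e : Sym2 (Site 3) | e ∉ ω}) i := by
    intro i a b Q hQ ha hb
    exact exists_edge_not_mem i 1 (h i 1) Q
      (fun z hz => ⟨(hQ z hz).1, by simpa using (hQ z hz).2⟩) (by simpa using ha)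
      (by simpa using hb)
  have hneg : ∀ (i : Fin 3) (a b : Site 3) (Q : (zdGraph 3).Walk a b),
      (∀ z ∈ Q.support, (∀ j, -(2 * (n : ℤ)) ≤ z j ∧ z j ≤ 2 * (n : ℤ)) ∧ z i ≤ -(n : ℤ)) →
      a i = -(n : ℤ) → b i = -(2 * (n : ℤ)) →
      ∃ e ∈ Q.edges, e ∈ (fun _ : Fin 3 => {e : Sym2 (Site 3) | e ∉ ω}) i := by
    intro i a b Q hQ ha hb
    refine exists_edge_not_mem i (-1) (h i (-1)) Q (fun z hz => ⟨(hQ z hz).1, ?_⟩) ?_ ?_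
    · have h2 := (hQ z hz).2
      simp only [Units.val_neg, Units.val_one]
      omega
    · simp only [Units.val_neg, Units.val_one]
      omega
    · simp only [Units.val_neg, Units.val_one]
      omega
  obtain ⟨e, heP, he⟩ := shell_cutsets_glue (show (n : ℤ) ≤ 2 * (n : ℤ) by omega) hpos hneg P hP hx' hy'
  have he' : e ∉ ω := by
    rcases he with he | he <;> exact (Set.mem_iUnion.1 he).elim fun _ h => h
  exact he' (hPω e heP)

/-- **Assembly of the measure-theoretic step.** Six decreasing measurable events of common
probability `v` whose intersection has probability at most `u` give `v ^ 6 ≤ u`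
(Harris–FKG for finitely many decreasing events, `prob_pow_le_biInter_of_isLowerSet`, over the
index set `Fin 3 × ℤˣ` of cardinality `6`). -/
theorem pow_six_le (p : unitInterval) {E : Fin 3 × ℤˣ → Set (BondConfig (Site 3))} {v u : ℝ}
    (hE : ∀ q, (bondPercolation (zdGraph 3) p).real (E q) = v) (hL : ∀ q, IsLowerSet (E q))
    (hM : ∀ q, MeasurableSet (E q))
    (hu : (bondPercolation (zdGraph 3) p).real (⋂ q ∈ (Finset.univ : Finset (Fin 3 × ℤˣ)), E q) ≤ u) :
    v ^ 6 ≤ u := by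
  have h1 := prob_pow_le_biInter_of_isLowerSet (zdGraph 3) p Finset.univ E (fun q _ => hL q)
    (fun q _ => hM q) (fun q _ => hE q)
  have h2 : (Finset.univ : Finset (Fin 3 × ℤˣ)).card = 6 := by
    rw [Finset.card_univ]
    simp [Fintype.card_prod, Fintype.card_units_int]
  rw [h2] at h1
  exact h1.trans hu

end StubSixSlab

/-- **Registered stub `stub_sixSlab`** (line `cross-sandwich-flat-seal`, crux
`SubpolynomialBlocking`): the LOWER SANDWICH `V_n ^ 6 ≤ u_n` for `n ≥ 1`, where
`u_n = blockProb 3 p_c n = P_{p_c}((annulusCrossing 3 n)ᶜ)` and `V_n` is the probability that the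
face-slab `[n, 2n] × [-2n, 2n]²` is sealed across direction `0` (no open path inside it from
`{x₀ = n}` to `{x₀ = 2n}`). Proof: the six signed-permutation images of the seal have probability
`V_n` each (symmetry), are decreasing and measurable (Harris–FKG, `∏ ≤ P(⋂)`), and together close
the shell `Λ_{2n} ∖ Λ_n` (`shell_cutsets_glue`), an event contained in `(annulusCrossing 3 n)ᶜ`
up to the null set of non-lattice configurations. (Grimmett 1999, Thm. 2.4 and §1.6.) -/
theorem stub_sixSlab :
    ∀ n : ℕ, 1 ≤ n →
      (bondPercolation (zdGraph 3) (criticalProbI 3)).real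
          (openCrossing (Set.Icc (![(n : ℤ), -(2 * (n : ℤ)), -(2 * (n : ℤ))] : Site 3)
              ![2 * (n : ℤ), 2 * (n : ℤ), 2 * (n : ℤ)])
            {x | x ∈ Set.Icc (![(n : ℤ), -(2 * (n : ℤ)), -(2 * (n : ℤ))] : Site 3)
              ![2 * (n : ℤ), 2 * (n : ℤ), 2 * (n : ℤ)] ∧ x 0 = (n : ℤ)}
            {y | y ∈ Set.Icc (![(n : ℤ), -(2 * (n : ℤ)), -(2 * (n : ℤ))] : Site 3)
              ![2 * (n : ℤ), 2 * (n : ℤ), 2 * (n : ℤ)] ∧ y 0 = 2 * (n : ℤ)})ᶜ ^ 6 ≤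
        blockProb 3 (criticalProbI 3) n := by
  intro n _
  refine StubSixSlab.pow_six_le (criticalProbI 3)
    (E := fun q : Fin 3 × ℤˣ => (openCrossing
        ((zdSignedPermIso (Equiv.swap (0 : Fin 3) q.1) (fun _ => q.2)) ''
          Set.Icc (![(n : ℤ), -(2 * (n : ℤ)), -(2 * (n : ℤ))] : Site 3)
            ![2 * (n : ℤ), 2 * (n : ℤ), 2 * (n : ℤ)])
        ((zdSignedPermIso (Equiv.swap (0 : Fin 3) q.1) (fun _ => q.2)) ''
          {x | x ∈ Set.Icc (![(n : ℤ), -(2 * (n : ℤ)), -(2 * (n : ℤ))] : Site 3)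
            ![2 * (n : ℤ), 2 * (n : ℤ), 2 * (n : ℤ)] ∧ x 0 = (n : ℤ)})
        ((zdSignedPermIso (Equiv.swap (0 : Fin 3) q.1) (fun _ => q.2)) ''
          {y | y ∈ Set.Icc (![(n : ℤ), -(2 * (n : ℤ)), -(2 * (n : ℤ))] : Site 3)
            ![2 * (n : ℤ), 2 * (n : ℤ), 2 * (n : ℤ)] ∧ y 0 = 2 * (n : ℤ)}))ᶜ)
    (fun q => StubSixSlab.real_compl_openCrossing_image _ _ _ _ _)
    (fun q => (isUpperSet_openCrossing _ _ _).compl)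
    (fun q => (measurableSet_openCrossing_of_countable _ _ _).compl) ?_
  refine real_mono_of_forall_subset_edgeSet (zdGraph 3) (criticalProbI 3) fun ω hω hωE => ?_
  exact StubSixSlab.not_mem_annulusCrossing hω fun i ε => Set.mem_iInter₂.1 hωE (i, ε) (Finset.mem_univ _)

end Summit.CriticalPhenomena.PercolationContinuityZ3.Theorems.SubpolynomialBlocking

end
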